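import Literature.Analysis.FunctionSpaces.SLEBesselIto
import Literature.Probability.RandomPlanarGeometry.SLEOnePointSwallowingProofs
import Literature.Probability.RandomPlanarGeometry.SLEOnePointMartingaleProofs
import Literature.Probability.RandomPlanarGeometry.CritPercSLELocalityMartingaleProofs
import Literature.Probability.Process.PathRegularization
import HarnessLib

/-!
# Bessel processes of dimension `1 < δ < 2` hit `0`: a proof through SLE_κ, `κ > 4`

Topic `Analysis/FunctionSpaces`; theorems only. We PROVE, on the canonical space, the statement
"for `1 < δ < 2` and `x₀ > 0` the Bessel process `BES^δ(x₀)` reaches `0` almost surely"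
(Revuz–Yor, Ch. XI §1, p. 442: "for `0 ≤ δ < 2` the point `0` is reached a.s."; Lawler (2005),
Prop. 1.21 (ii): "if `a < 1/2`, then w.p.1 `T_x < ∞`") for the tree's notion
`Literature.Analysis.FunctionSpaces.IsBesselProcess` driven by the canonical Brownian motion
(`IsBesselProcess.ae_exists_eq_zero_of_lt_two`). It is the canonical sub-case of the
general-filtration named fact `IsBesselProcess.ae_exists_eq_zero` (`ItoProcesses.lean`) consumed
by [LSW] Lemma 8.3 (3) (`Literature/Probability/RandomPlanarGeometry/SLEKappaRhoRealLine.lean`,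
hypothesis `h₄` of `SLEKappaRho.swallowingTime_ofReal_of`), which thereby no longer depends on an
unproved hitting fact.

The proof reads Lawler's identification "Prop. 6.8 is a restatement of Prop. 1.21 with
`a = 2/κ`" BACKWARDS: the tree has proved that SLE_κ swallows every real `x > 0` when `κ > 4`
(`sle_swallowingTime_lt_top_of_onePointMartingales` with the discharged one-point martingales
`sle_martingale_onePointPow_holds`, `sle_martingale_onePointSq_holds`, i.e. Lawler's Prop. 1.21
(ii) for the real SLE flow), and the SLE–Bessel bridge identifies, path by path, a Bessel process
with the real flow of a Loewner chain before the swallowing time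
(`Loewner.pos_and_eq_re_map_sub_of_flowEq`, `SLEBessel.lean`). Given `1 < δ < 2`, put
`κ = 4/(δ - 1) > 4` and let `Y = √Z`, `Z = BESQ^δ(x₀²)` driven by `B`. Then:

* **Itô for `√Z` before `T₀`, driver `+B`** (`IsSquaredBesselProcess.ae_sqrt_eq_brownian`):
  a.s., for every `t` with `Z > 0` on `[0, t]`, `√Z_t = x₀ + B_t + ((δ-1)/2) ∫₀ᵗ (√Z_s)⁻¹ ds` —
  the `+B` twin of the tree's `IsSquaredBesselProcess.ae_sqrt_eq_neg_brownian` (`SLEBesselIto`),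
  same proof;
* hence `y = √κ Y` solves the flow equation `y_t + W_t = x + ∫₀ᵗ 2/y_s ds`, `x = √κ x₀`, for the
  REFLECTED driving function `W = -√κ B` as long as `y > 0`, so that `y` is the real Loewner flow
  of `x` under `W` before `T_x(W)` (deterministic core);
* `T_x(-√κ B) < ∞` a.s. for `κ > 4`: the tree's theorem for `+√κ B` transferred along the
  reflection symmetry in law `identDistrib_sleDriving_neg` (`ae_swallowingTime_lt_top_of_identDistrib`,
  the event being read through the measurable path regularisation `pathRegularize`);
* if `Y` never vanished, `y` would equal the frozen flow for all `t < T_x` and, both being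
  continuous, also at `T_x`, where the frozen flow is `0` — so `Y_{T_x} = 0`.

## References

* D. Revuz, M. Yor, *Continuous Martingales and Brownian Motion* (3rd ed., 1999), Ch. XI §1,
  p. 442 and the display after Def. (1.9), p. 446.
* G. F. Lawler, *Conformally Invariant Processes in the Plane*, AMS (2005), §1.10 Prop. 1.21,
  §6.2 Prop. 6.8.
* S. Rohde, O. Schramm, *Basic properties of SLE*, Ann. of Math. 161 (2005), §6, Lemma 6.2 and
  the remark after it, Lemma 6.5.
-/

open MeasureTheory ProbabilityTheory Filter Set
open scoped NNReal ENNReal Topology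

noncomputable section

namespace Literature.Analysis.FunctionSpaces

open Literature.Probability.Process Literature.Probability.RandomPlanarGeometry

/-! ### Itô's formula for `√Z` before `T₀`, driver `+B` -/

section SqrtIto

variable {a : ℝ} {f : ℝ → ℝ} {z : ℝ}

/-- On `{z > a}` the Itô integrand `σ f'(z) = 2√|z| · (1/(2√z))` of a modification `f` of `√·` on
`(a, ∞)`, `a > 0`, is the constant `1`. [folklore] -/
theorem two_sqrt_mul_deriv_of_eq_sqrt (hf : ∀ z, a < z → f z = Real.sqrt z) (ha : 0 < a)
    (hz : a < z) : 2 * Real.sqrt |z| * deriv f z = 1 := by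
  have h := neg_two_sqrt_mul_deriv_of_eq_sqrt hf ha hz
  rw [neg_mul] at h
  linarith

variable {δ z₀ : ℝ} {Z : ℝ≥0 → (ℝ≥0 → ℝ) → ℝ}

/-- **Itô's formula for a modified square root along a squared Bessel process driven by `+B`,
localised** (progressive version of the solution, fixed level `a > 0`): the `+B` twin of
`IsSquaredBesselProcess.ae_sqrt_eq_of_level` — almost surely, for every `t` admitting a rational
`q ≥ t` with `Z > a` on `[0, q]`, `√Z_t = √Z_0 + B_t + ((δ-1)/2) ∫₀ᵗ (√Z_s)⁻¹ ds`.
Revuz–Yor, *Continuous Martingales and Brownian Motion* (1999), Ch. IV, Prop. (2.11), Thm (3.3);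
Ch. XI, §1, display after Def. (1.9). [folklore] -/
theorem IsSquaredBesselProcess.ae_sqrt_eq_of_level_brownian
    (hZ : IsSquaredBesselProcess δ z₀ Z brownian brownianFiltration preWienerMeasure)
    (hprog : IsStronglyProgressive brownianFiltration Z) {a : ℝ} (ha : 0 < a) :
    ∀ᵐ ω ∂preWienerMeasure, ∀ t : ℝ≥0,
      (∃ q : ℚ, t ≤ (q : ℝ).toNNReal ∧ ∀ s ≤ (q : ℝ).toNNReal, a < Z s ω) →
        Real.sqrt (Z t ω) = Real.sqrt (Z 0 ω) + brownian t ω +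
          (δ - 1) / 2 * ∫ s in (0 : ℝ)..t, (Real.sqrt (Z s.toNNReal ω))⁻¹ := by
  obtain ⟨-, hZa, hint, J, hJ, heq⟩ := hZ
  -- `Z = Z₀ + δ t + ∫ σ dB` with `σ = 2√|Z|`, an Itô process driven by `B`
  have hX : IsItoProcess Z (fun _ _ ↦ δ) (fun s ω ↦ 2 * Real.sqrt |Z s ω|) brownian
      brownianFiltration preWienerMeasure :=
    ⟨hint, J, hJ, heq⟩
  have hσ : IsStronglyProgressive brownianFiltration (fun s ω ↦ 2 * Real.sqrt |Z s ω|) :=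
    IsStronglyProgressive.comp_measurable₂ hprog
      (F := fun (_ : ℝ) (z : ℝ) ↦ 2 * Real.sqrt |z|)
      (continuous_const.mul (Real.continuous_sqrt.comp
        (continuous_abs.comp continuous_snd))).measurable
  -- Itô's formula for a `C²` modification `f` of `√·` on `(a, ∞)`
  obtain ⟨f, hfc, hf⟩ := exists_contDiff_eq_sqrt_of_lt ha
  have hf2 : ContDiff ℝ 2 (Function.uncurry fun (_ : ℝ) ↦ f) := hfc.comp contDiff_snd
  have hf1 : ContDiff ℝ 1 (Function.uncurry fun (_ : ℝ) ↦ f) := hf2.of_le (by norm_num)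
  obtain ⟨K, hK⟩ := exists_isItoIntegral_mul_of_continuous exists_isItoIntegral_holds hσ hJ
    (adapted_deriv_apply hf1 hZa) (hX.ae_continuous_deriv_apply hf1)
  have hI := ito_formula_itoProcess_ae_holds (fun (_ : ℝ) ↦ f) hf2 hZa hσ hX hK
  -- local character of `K` on `E_q = {Z > a on [0, q]}`: there `σ f'(Z) = 1`, so `K = B`
  have hloc : ∀ q : ℚ, ∀ᵐ ω ∂preWienerMeasure,
      ω ∈ {ω | ∀ s ≤ (q : ℝ).toNNReal, a < Z s ω} →
        ∀ s ≤ (q : ℝ).toNNReal, 1 * brownian s ω = K s ω := fun q ↦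
    (isItoIntegral_const_brownian 1).ae_eqOn_of_brownian hK
      (ae_of_all _ fun _ ↦ measurable_const)
      fun ω hω s hs ↦ (two_sqrt_mul_deriv_of_eq_sqrt hf ha (hω s hs)).symm
  filter_upwards [hI, ae_all_iff.2 hloc] with ω hIω hLω
  rintro t ⟨q, htq, hq⟩
  have hZgt : ∀ s ≤ t, a < Z s ω := fun s hs ↦ hq s (hs.trans htq)
  have hKt : K t ω = brownian t ω := by
    rw [← hLω q hq t htq, one_mul]
  have h1 := hIω t
  -- the drift integral
  have hdrift : (∫ s in (0 : ℝ)..t,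
      (deriv (fun r : ℝ ↦ f (Z s.toNNReal ω)) (s.toNNReal : ℝ) + δ * deriv f (Z s.toNNReal ω) +
        2⁻¹ * (2 * Real.sqrt |Z s.toNNReal ω|) ^ 2 * iteratedDeriv 2 f (Z s.toNNReal ω))) =
      (δ - 1) / 2 * ∫ s in (0 : ℝ)..t, (Real.sqrt (Z s.toNNReal ω))⁻¹ := by
    rw [← intervalIntegral.integral_const_mul]
    refine intervalIntegral.integral_congr fun s hs ↦ ?_
    rw [Set.uIcc_of_le t.coe_nonneg] at hs
    have := itoDrift_of_eq_sqrt hf ha (hZgt _ (Real.toNNReal_le_iff_le_coe.2 hs.2)) δ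
      (s.toNNReal : ℝ)
    rw [neg_sq] at this
    exact this
  rw [hdrift, hKt, hf _ (hZgt t le_rfl), hf _ (hZgt 0 zero_le)] at h1
  linarith

/-- **Itô's formula for `√Z` before the hitting time of `0`, driver `+B`, progressive case**:
the `+B` twin of `IsSquaredBesselProcess.ae_sqrt_eq_of_isStronglyProgressive`.
Revuz–Yor, *Continuous Martingales and Brownian Motion* (1999), Ch. XI, §1, display after
Def. (1.9). [folklore] -/
theorem IsSquaredBesselProcess.ae_sqrt_eq_of_isStronglyProgressive_brownian
    (hZ : IsSquaredBesselProcess δ z₀ Z brownian brownianFiltration preWienerMeasure)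
    (hprog : IsStronglyProgressive brownianFiltration Z) :
    ∀ᵐ ω ∂preWienerMeasure, ∀ t : ℝ≥0, (∀ s ≤ t, 0 < Z s ω) →
      Real.sqrt (Z t ω) = Real.sqrt z₀ + brownian t ω +
        (δ - 1) / 2 * ∫ s in (0 : ℝ)..t, (Real.sqrt (Z s.toNNReal ω))⁻¹ := by
  have hlev := fun n : ℕ ↦
    hZ.ae_sqrt_eq_of_level_brownian hprog (a := 1 / ((n : ℝ) + 1)) Nat.one_div_pos_of_nat
  have h0 : ∀ ω, Z 0 ω = z₀ := hZ.apply_zero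
  filter_upwards [ae_all_iff.2 hlev, IsStrongSolution.ae_continuous hZ] with ω hω hcω t ht
  -- a level `1/(n+1)` below `min_{[0,t]} Z`
  obtain ⟨s₀, hs₀, hmin⟩ := (isCompact_Icc (a := (0 : ℝ≥0)) (b := t)).exists_isMinOn
    (Set.nonempty_Icc.2 zero_le) hcω.continuousOn
  obtain ⟨n, hn⟩ := exists_nat_one_div_lt (ht s₀ hs₀.2)
  have hZgt : ∀ s ≤ t, 1 / ((n : ℝ) + 1) < Z s ω := fun s hs ↦
    hn.trans_le ((isMinOn_iff.1 hmin) s ⟨zero_le, hs⟩)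
  -- the path stays above the level up to some rational `q > t`
  have hnhds : (fun s ↦ Z s ω) ⁻¹' Set.Ioi (1 / ((n : ℝ) + 1)) ∈ 𝓝 t :=
    hcω.continuousAt.preimage_mem_nhds (Ioi_mem_nhds (hZgt t le_rfl))
  obtain ⟨ε, hε, hball⟩ := Metric.mem_nhds_iff.1 hnhds
  obtain ⟨q, hq1, hq2⟩ := exists_rat_btwn (lt_add_of_pos_right (t : ℝ) hε)
  have hq0 : (0 : ℝ) ≤ q := t.coe_nonneg.trans hq1.le
  have hcoe : (((q : ℝ).toNNReal : ℝ≥0) : ℝ) = q := Real.coe_toNNReal _ hq0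
  have htq : t ≤ (q : ℝ).toNNReal := by
    rw [← NNReal.coe_le_coe, hcoe]
    exact hq1.le
  have hmem : ∀ s ≤ (q : ℝ).toNNReal, 1 / ((n : ℝ) + 1) < Z s ω := by
    intro s hs
    rcases le_or_gt s t with hst | hst
    · exact hZgt s hst
    · apply hball
      rw [Metric.mem_ball, NNReal.dist_eq]
      have h1 : (t : ℝ) < s := NNReal.coe_lt_coe.2 hst
      have h2 : (s : ℝ) ≤ q := by
        rw [← hcoe]
        exact NNReal.coe_le_coe.2 hs
      rw [abs_of_pos (sub_pos.2 h1)]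
      linarith
  have key := hω n t ⟨q, htq, hmem⟩
  rwa [h0 ω] at key

/-- **Itô's formula for `√Z` before the hitting time of `0`, driver `+B`** (Revuz–Yor, Ch. XI,
§1, display after Def. (1.9), p. 446: "`X_t^{1/2} = √x + β_t + ((δ-1)/2) ∫₀ᵗ X_s^{-1/2} ds` …
BES^δ(a), `a > 0`, is a solution to the SDE `ρ_t = a + β_t + ((δ-1)/2) ∫₀ᵗ ρ_s⁻¹ ds`"): if `Z`
solves the squared Bessel equation `dZ = δ dt + 2√|Z| dB`, `Z₀ = z₀`, driven by the canonical
Brownian motion (raw Brownian filtration), then almost surely, for every `t` with `Z > 0` on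
`[0, t]`, `√Z_t = √z₀ + B_t + ((δ - 1)/2) ∫₀ᵗ (√Z_s)⁻¹ ds`. The `+B` twin of the tree's
`IsSquaredBesselProcess.ae_sqrt_eq_neg_brownian` (same proof: reduction to the progressive case
by `dyadicReg`). [cite: RevuzYor1999, Ch. XI §1 Def. (1.9) and the display after it (p. 446)] -/
theorem IsSquaredBesselProcess.ae_sqrt_eq_brownian
    (hZ : IsSquaredBesselProcess δ z₀ Z brownian brownianFiltration preWienerMeasure) :
    ∀ᵐ ω ∂preWienerMeasure, ∀ t : ℝ≥0, (∀ s ≤ t, 0 < Z s ω) →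
      Real.sqrt (Z t ω) = Real.sqrt z₀ + brownian t ω +
        (δ - 1) / 2 * ∫ s in (0 : ℝ)..t, (Real.sqrt (Z s.toNNReal ω))⁻¹ := by
  obtain ⟨hZ', hprog, hae⟩ := IsStrongSolution.dyadicReg_spec hZ
  filter_upwards [IsSquaredBesselProcess.ae_sqrt_eq_of_isStronglyProgressive_brownian hZ' hprog,
    hae] with ω hω hωeq t ht
  have h := hω t fun s hs ↦ by rw [hωeq]; exact ht s hs
  simpa only [hωeq] using h

end SqrtIto

/-! ### Swallowing under the reflected SLE_κ driving function, `κ > 4` -/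

namespace Loewner

/-- **Law transfer for the event `{T_x < ∞}`.** If two families of continuous driving paths
vanishing at `0` have the same law on the path space and the chain of the first swallows `x > 0`
in finite time almost surely, so does the chain of the second. The event is read on the path
space through the regularised path `pathRegularize w - pathRegularize w 0` (measurable in `w`,
continuous in time, equal to `w` for continuous `w` with `w 0 = 0`), for which `{T_x < ⊤}` is
measurable (`Loewner.measurableSet_swallowingTime_lt_top`). [folklore] -/
theorem ae_swallowingTime_lt_top_of_identDistrib {Ω : Type*} [MeasurableSpace Ω]
    {P : Measure Ω} {W₁ W₂ : Ω → ℝ≥0 → ℝ} (hc₁ : ∀ ω, Continuous (W₁ ω))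
    (hc₂ : ∀ ω, Continuous (W₂ ω)) (h0₁ : ∀ ω, W₁ ω 0 = 0) (h0₂ : ∀ ω, W₂ ω 0 = 0)
    (hid : IdentDistrib W₁ W₂ P P) {x : ℝ} (hx : 0 < x)
    (h : ∀ᵐ ω ∂P, Literature.Probability.RandomPlanarGeometry.Loewner.swallowingTime (W₁ ω) x < ⊤) :
    ∀ᵐ ω ∂P, Literature.Probability.RandomPlanarGeometry.Loewner.swallowingTime (W₂ ω) x < ⊤ := by
  -- the regularised path, recentred at time `0`
  set R : (ℝ≥0 → ℝ) → ℝ≥0 → ℝ := fun w u ↦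
    pathRegularize w u - pathRegularize w 0 with hR
  have hRc : ∀ w, Continuous (R w) := fun w ↦
    (continuous_pathRegularize w).sub continuous_const
  have hR0 : ∀ w, R w 0 = 0 := fun w ↦ sub_self _
  have hRm : ∀ u, Measurable fun w ↦ R w u := fun u ↦
    (measurable_pathRegularize u).sub (measurable_pathRegularize 0)
  have hRid : ∀ w : ℝ≥0 → ℝ, Continuous w → w 0 = 0 → R w = w := by
    intro w hw hw0
    ext u
    simp [hR, pathRegularize_eq_self_of_continuous hw, hw0]
  set S : Set (ℝ≥0 → ℝ) := {w |
    Literature.Probability.RandomPlanarGeometry.Loewner.swallowingTime (R w) x < ⊤} with hS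
  have hSm : MeasurableSet S :=
    Literature.Probability.RandomPlanarGeometry.Loewner.measurableSet_swallowingTime_lt_top
      (W := R) hRc hR0 hRm hx.ne'
  have hm₁ : ∀ᵐ ω ∂P, W₁ ω ∈ S := by
    filter_upwards [h] with ω hω
    show Literature.Probability.RandomPlanarGeometry.Loewner.swallowingTime (R (W₁ ω)) x < ⊤
    rwa [hRid _ (hc₁ ω) (h0₁ ω)]
  have hm₂ : ∀ᵐ ω ∂P, W₂ ω ∈ S := by
    have h1 : P (W₁ ⁻¹' Sᶜ) = 0 := ae_iff.1 hm₁
    have h2 : P (W₂ ⁻¹' Sᶜ) = 0 := by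
      rw [← hid.measure_mem_eq hSm.compl]
      exact h1
    exact ae_iff.2 h2
  filter_upwards [hm₂] with ω hω
  have : Literature.Probability.RandomPlanarGeometry.Loewner.swallowingTime (R (W₂ ω)) x < ⊤ := hω
  rwa [hRid _ (hc₂ ω) (h0₂ ω)] at this

end Loewner

/-- **The chain driven by the reflected SLE_κ driving function `-√κ B` swallows every `x > 0` in
finite time when `κ > 4`** (Rohde–Schramm (2005), Lemma 6.5; Lawler (2005), Prop. 6.8 (ii)):
the tree's theorem for `+√κ B` (`sle_swallowingTime_lt_top_of_onePointMartingales` with the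
discharged one-point martingales) transferred along the reflection symmetry in law
`identDistrib_sleDriving_neg`. [cite: RohdeSchramm2005, §6 Lemma 6.5 and proof of Lemma 6.2] -/
theorem ae_swallowingTime_neg_sleDriving_lt_top {κ : ℝ≥0} (hκ : 4 < κ) {x : ℝ} (hx : 0 < x) :
    ∀ᵐ ω ∂preWienerMeasure,
      Literature.Probability.RandomPlanarGeometry.Loewner.swallowingTime (fun t ↦ -sleDriving κ ω t) x < ⊤ :=
  Loewner.ae_swallowingTime_lt_top_of_identDistrib (W₁ := fun ω t ↦ sleDriving κ ω t)
    (W₂ := fun ω t ↦ -sleDriving κ ω t) (continuous_sleDriving κ)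
    (fun ω ↦ (continuous_sleDriving κ ω).neg) (sleDriving_zero κ) (fun ω ↦ by simp)
    (identDistrib_sleDriving_neg κ) hx
    (sle_swallowingTime_lt_top_of_onePointMartingales sle_martingale_onePointPow_holds
      sle_martingale_onePointSq_holds hκ hx)

/-! ### Bessel processes of dimension `1 < δ < 2` reach `0` -/

/-- `κ = 4/(δ - 1)` as a nonnegative real, for `δ > 1`: the SLE parameter with Bessel dimension
`1 + 4/κ = δ` (Lawler (2005), Prop. 6.8: "Proposition 1.21 with `a = 2/κ`"). [folklore] -/
theorem exists_nnreal_kappa_of_one_lt {δ : ℝ} (hδ1 : 1 < δ) (hδ2 : δ < 2) :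
    ∃ κ : ℝ≥0, 4 < κ ∧ (δ - 1) / 2 = 2 / (κ : ℝ) ∧ (0 : ℝ) < κ := by
  have hpos : 0 < 4 / (δ - 1) := div_pos four_pos (sub_pos.2 hδ1)
  refine ⟨⟨4 / (δ - 1), hpos.le⟩, ?_, ?_, ?_⟩
  · rw [← NNReal.coe_lt_coe]
    show (4 : ℝ) < 4 / (δ - 1)
    rw [lt_div_iff₀ (sub_pos.2 hδ1)]
    linarith
  · show (δ - 1) / 2 = 2 / (4 / (δ - 1))
    field_simp
    ring
  · exact hpos

/-- **Bessel processes of dimension `1 < δ < 2` reach `0` almost surely** (Revuz–Yor, Ch. XI §1,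
p. 442: "for `0 ≤ δ < 2` the point `0` is reached a.s."; Lawler (2005), Prop. 1.21 (ii): "if
`a < 1/2`, then w.p.1 `T_x < ∞`"), on the canonical space and for the tree's notion
`IsBesselProcess` (every Bessel process `Y = √(BESQ^δ(x₀²))` driven by the canonical Brownian
motion, `x₀ > 0`). Proof through SLE_κ with `κ = 4/(δ-1) > 4` (Lawler's "Prop. 6.8 is Prop. 1.21
with `a = 2/κ`" read backwards): by Itô's formula for `√Z` before `T₀`
(`IsSquaredBesselProcess.ae_sqrt_eq_brownian`) the path `y = √κ Y` solves the flow equation of the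
chain driven by `W = -√κ B` from `x = √κ x₀` as long as it is positive, hence IS the real
Loewner flow of `x` before `T_x(W)` (`Loewner.pos_and_eq_re_map_sub_of_flowEq`); and
`T_x(W) < ∞` a.s. (`ae_swallowingTime_neg_sleDriving_lt_top`), where the frozen flow vanishes
(`continuous_realFlowStop`): if `Y` never vanished, continuity would force `y_{T_x} = 0`.
This is the canonical sub-case of the named fact `IsBesselProcess.ae_exists_eq_zero`
(`ItoProcesses.lean`). [cite: RevuzYor1999, Ch. XI §1 p. 442] -/
theorem IsBesselProcess.ae_exists_eq_zero_of_lt_two {δ x₀ : ℝ} {Y : ℝ≥0 → (ℝ≥0 → ℝ) → ℝ}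
    (hδ1 : 1 < δ) (hδ2 : δ < 2) (hx₀ : 0 < x₀)
    (hY : IsBesselProcess δ x₀ Y brownian brownianFiltration preWienerMeasure) :
    ∀ᵐ ω ∂preWienerMeasure, ∃ t : ℝ≥0, Y t ω = 0 := by
  obtain ⟨Z, hZ, hYZ⟩ := hY
  obtain ⟨κ, hκ4, hδκ, hκ0⟩ := exists_nnreal_kappa_of_one_lt hδ1 hδ2
  have hsκ : 0 < Real.sqrt κ := Real.sqrt_pos.2 hκ0
  set x : ℝ := Real.sqrt κ * x₀ with hxdef
  have hx : 0 < x := mul_pos hsκ hx₀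
  have hcont : ∀ᵐ ω ∂preWienerMeasure, Continuous (Z · ω) := IsStrongSolution.ae_continuous hZ
  filter_upwards [hZ.ae_sqrt_eq_brownian, hcont, ae_swallowingTime_neg_sleDriving_lt_top hκ4 hx]
    with ω hSω hcω hTω
  by_contra hne
  push Not at hne
  -- `Y > 0` everywhere, hence `Z > 0` everywhere
  have hZpos : ∀ t, 0 < Z t ω := by
    intro t
    by_contra h
    rw [not_lt] at h
    exact hne t (by rw [hYZ t ω]; exact Real.sqrt_eq_zero'.2 h)
  -- the reflected driving function and the scaled process
  set W : ℝ≥0 → ℝ := fun t ↦ -sleDriving κ ω t with hWdef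
  have hWc : Continuous W := (continuous_sleDriving κ ω).neg
  have hW0 : W 0 = 0 := by simp [hWdef]
  set y : ℝ≥0 → ℝ := fun t ↦ Real.sqrt κ * Real.sqrt (Z t ω) with hydef
  have hyc : Continuous y := continuous_const.mul (Real.continuous_sqrt.comp hcω)
  have hy0 : y 0 = x := by
    simp only [hydef, hxdef]
    rw [hZ.apply_zero ω, Real.sqrt_sq hx₀.le]
  have hypos : ∀ t, 0 < y t := fun t ↦ mul_pos hsκ (Real.sqrt_pos.2 (hZpos t))
  -- the flow equation for `y` under `W = -√κ B`
  have hflow : ∀ t : ℝ≥0, (∀ s ≤ t, 0 < y s) →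
      y t + W t = x + ∫ s in (0 : ℝ)..t, 2 / y s.toNNReal := by
    intro t _
    have h1 := hSω t fun s _ ↦ hZpos s
    set I : ℝ := ∫ s in (0 : ℝ)..t, (Real.sqrt (Z s.toNNReal ω))⁻¹ with hIdef
    have hI : (∫ s in (0 : ℝ)..t, 2 / y s.toNNReal) = 2 / Real.sqrt κ * I := by
      rw [hIdef, ← intervalIntegral.integral_const_mul]
      refine intervalIntegral.integral_congr fun s _ ↦ ?_
      simp only [hydef]
      rw [div_mul_eq_div_div, div_eq_mul_inv]
    have hκsq : Real.sqrt κ * Real.sqrt κ = κ := Real.mul_self_sqrt hκ0.le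
    have hcoef : Real.sqrt κ * (2 / (κ : ℝ)) = 2 / Real.sqrt κ := by
      have h2 : (2 : ℝ) / κ = 2 / (Real.sqrt κ * Real.sqrt κ) := by rw [hκsq]
      rw [h2, div_mul_eq_div_div, mul_div_cancel₀ _ hsκ.ne']
    rw [hI]
    simp only [hydef, hWdef, sleDriving_apply, hxdef]
    rw [h1, hδκ, Real.sqrt_sq hx₀.le]
    have : Real.sqrt κ * (x₀ + brownian t ω + 2 / (κ : ℝ) * I) + -(Real.sqrt κ * brownian t ω) =
        Real.sqrt κ * x₀ + Real.sqrt κ * (2 / (κ : ℝ)) * I := by ring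
    rw [this, hcoef]
  -- `y` is the real flow of `x` before `T_x(W)`, which is finite
  obtain ⟨b, hb⟩ := WithTop.ne_top_iff_exists.1 hTω.ne
  have hb' : Literature.Probability.RandomPlanarGeometry.Loewner.swallowingTime W x = b := hb.symm
  have hxW : W 0 < x := by rwa [hW0]
  have hxW' : (x : ℂ) ≠ W 0 := fun h ↦ hxW.ne' (by exact_mod_cast h)
  have hb0 : 0 < b := by
    have := Literature.Probability.RandomPlanarGeometry.Loewner.swallowingTime_pos_holds hWc hxW'
    rw [hb'] at this
    exact_mod_cast this
  have heq : ∀ t : ℝ≥0, t < b →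
      y t = Literature.Probability.RandomPlanarGeometry.Loewner.realFlowStop W x t := by
    intro t ht
    have ht' : (t : WithTop ℝ≥0) <
        Literature.Probability.RandomPlanarGeometry.Loewner.swallowingTime W x := by
      rw [hb']; exact_mod_cast ht
    rw [Literature.Probability.RandomPlanarGeometry.Loewner.realFlowStop_of_lt ht',
      Literature.Probability.RandomPlanarGeometry.Loewner.realFlow]
    exact (Loewner.pos_and_eq_re_map_sub_of_flowEq hWc hW0 hx hyc hy0 hflow ht').2
  -- pass to the limit at `b`: the frozen flow vanishes there, `y` does not
  have huc := Literature.Probability.RandomPlanarGeometry.Loewner.continuous_realFlowStop hWc hxW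
  have hub : Literature.Probability.RandomPlanarGeometry.Loewner.realFlowStop W x b = 0 :=
    Literature.Probability.RandomPlanarGeometry.Loewner.realFlowStop_of_le (by rw [hb'])
  have hclosed : IsClosed {t : ℝ≥0 |
      y t = Literature.Probability.RandomPlanarGeometry.Loewner.realFlowStop W x t} :=
    isClosed_eq hyc huc
  have hbmem : b ∈ {t : ℝ≥0 |
      y t = Literature.Probability.RandomPlanarGeometry.Loewner.realFlowStop W x t} := by
    have hsub : closure (Ico 0 b) ⊆
        {t : ℝ≥0 | y t = Literature.Probability.RandomPlanarGeometry.Loewner.realFlowStop W x t} :=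
      closure_minimal (fun t ht ↦ heq t ht.2) hclosed
    rw [closure_Ico hb0.ne] at hsub
    exact hsub ⟨zero_le, le_rfl⟩
  have : y b = 0 := by rw [show y b = _ from hbmem, hub]
  exact absurd this (hypos b).ne'

end Literature.Analysis.FunctionSpaces
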